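import Summits.NavierStokesRegularity.NavierStokesRegularity.Theorems.LerayQuarterDissipationFiniteDissipationLiouvilleCriticalElement
import Summits.NavierStokesRegularity.NavierStokesRegularity.Theorems.DssFarFieldSlavingBlowupTypeIDssProfileSimilarityEnstrophyTimeOnlyThreshold
import HarnessLib

/-!
# Crux `FiniteDissipationLiouville` (stmt-NavierStokesRegularity-22144): the AMPLITUDE leaf with
# the explicit threshold `1` — a singular finite-dissipation profile has scale-invariant
# amplitude `√(−t)‖u(t,x)‖ > 1 − ε` somewhere in every long enough backward log-window

Theorems file of route `LerayQuarterDissipation` (seat ns-lqd-p1 g2; `--supports` the crux and its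
child stmt-22508). Navier–Stokes regularity is NOT proved by anything here; no summit is.

The tree's explicit Type-I gap (`…SimilarityEnstrophy.typeI_ancient_eq_zero_of_rate_lt_one`, cell
pub-ns-dss, row T31⁗): every Type-I ancient mild field in the KNSS gauge with constant `C < 1`
vanishes. This file upgrades "constant `< 1`" to "amplitude `≤ θ < 1` on log-time windows of
unbounded length", for members of the finite-dissipation stratum `𝒟` (where the apex singularity
persists along the scaling orbit, p1 g0):

* `notSingular_of_amplitude_lt_one_windows` — if for every `Λ > 1` some backward window
  `[Λ²τ, τ/Λ²]` (`τ < 0`) has `√(−t)‖u(t,x)‖ ≤ θ` for all its `t` and ALL `x`, with `θ < 1`, then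
  `u` is bounded at the apex (orbit limit along the windows has Type-I constant `θ < 1`, hence
  vanishes; persistence);
* `amplitude_exceeds_of_singular` — contrapositive, the quotable form: for a SINGULAR member and
  every `θ < 1` there is a window length such that every backward window `[Λ²τ, τ/Λ²]` contains a
  point with `θ < √(−t)‖u(t,x)‖` — the explicit-constant sharpening of `…Nondegenerate` (p590812);
* `amplitude_exceeds_farPast_of_singular`, `amplitude_exceeds_nearApex_of_singular` — hence
  `limsup_{t→−∞} sup_x √(−t)‖u‖ ≥ 1` and `limsup_{t→0⁻} sup_x √(−t)‖u‖ ≥ 1` for every singular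
  member of the stratum.
-/

noncomputable section

-- the summit and its single sub-problem share the name (CONVENTIONS §1), as in every Theorems file
set_option linter.dupNamespace false

namespace Summit.NavierStokesRegularity.NavierStokesRegularity.Theorems.FiniteDissipationLiouville.Amplitude

open MeasureTheory Set Filter Topology Metric Function
open Literature.Analysis Literature.Analysis.FluidPDE
open scoped ENNReal NNReal

/-- **Sub-unit amplitude on long windows forces apex regularity.** Let `u` be Type-I ancient mild
(constant `C`) with the quarter-rate law (constant `K`). If `θ < 1` and for every `Λ > 1` there is
`τ < 0` with `√(−t)‖u(t,x)‖ ≤ θ` for all `t ∈ [Λ²τ, τ/Λ²]` and all `x`, then `u` is bounded on some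
backward cylinder at the origin. -/
theorem notSingular_of_amplitude_lt_one_windows {C K θ : ℝ} (hθ : θ < 1)
    {u : ℝ → EuclideanSpace ℝ (Fin 3) → EuclideanSpace ℝ (Fin 3)} (hu : IsTypeIAncientMild C u)
    (hlaw : ∀ s : ℝ, s < 0 → ∫⁻ x, ‖fderiv ℝ (u s) x‖ₑ ^ 2 ≤ ENNReal.ofReal (K / Real.sqrt (-s)))
    (hwin : ∀ Λ : ℝ, 1 < Λ → ∃ τ : ℝ, τ < 0 ∧ ∀ t ∈ Set.Icc (Λ ^ 2 * τ) (τ / Λ ^ 2), ∀ x,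
      Real.sqrt (-t) * ‖u t x‖ ≤ θ) :
    ¬ (∀ r > 0, ∀ M : ℝ, ∃ t ∈ Set.Ioo (-(r ^ 2)) (0 : ℝ),
        ∃ x ∈ Metric.ball (0 : EuclideanSpace ℝ (Fin 3)) r, M < ‖u t x‖) := by
  intro hsing
  -- windows at `Λ_k = k + 2`, scales `l_k = √(-τ_k)`
  have hΛ : ∀ k : ℕ, (1 : ℝ) < (k : ℝ) + 2 := fun k => by
    have : (0 : ℝ) ≤ k := Nat.cast_nonneg k
    linarith
  choose τ hτ hτwin using fun k : ℕ => hwin ((k : ℝ) + 2) (hΛ k)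
  set l : ℕ → ℝ := fun k => Real.sqrt (-τ k) with hl_def
  have hl : ∀ k, 0 < l k := fun k => Real.sqrt_pos.2 (neg_pos.2 (hτ k))
  have hl2 : ∀ k, l k ^ 2 = -τ k := fun k => Real.sq_sqrt (neg_pos.2 (hτ k)).le
  -- the rescaled amplitude bound, eventually for every fixed `s < 0`
  have hev : ∀ s : ℝ, s < 0 → ∀ᶠ k : ℕ in atTop, ∀ y,
      Real.sqrt (-s) * ‖nsRescale (l k) u s y‖ ≤ θ := by
    intro s hs
    have hT : Tendsto (fun k : ℕ => ((k : ℝ) + 2) ^ 2) atTop atTop :=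
      (tendsto_pow_atTop two_ne_zero).comp
        (tendsto_atTop_add_const_right atTop (2 : ℝ) tendsto_natCast_atTop_atTop)
    filter_upwards [hT.eventually_ge_atTop (-s), hT.eventually_ge_atTop (-s⁻¹)] with k h1 h2 y
    have hτ' : 0 < -τ k := neg_pos.2 (hτ k)
    have hs' : 0 < -s := neg_pos.2 hs
    -- the rescaled time `l_k² s` lies in the `k`-th window
    have hmem : l k ^ 2 * s ∈ Set.Icc (((k : ℝ) + 2) ^ 2 * τ k) (τ k / ((k : ℝ) + 2) ^ 2) := by
      rw [hl2 k]
      refine ⟨by nlinarith, ?_⟩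
      have hΛ2 : (0 : ℝ) < ((k : ℝ) + 2) ^ 2 := by positivity
      rw [le_div_iff₀ hΛ2]
      have h3 : 1 ≤ (-s) * ((k : ℝ) + 2) ^ 2 := by
        have := mul_le_mul_of_nonneg_left h2 hs'.le
        rwa [show (-s) * (-s⁻¹) = 1 by rw [neg_mul_neg, mul_inv_cancel₀ hs.ne]] at this
      nlinarith
    have key := hτwin k (l k ^ 2 * s) hmem (l k • y)
    -- `√(-s) ‖u_l(s,y)‖ = √(-(l² s)) ‖u(l² s, l y)‖`
    have hsq : Real.sqrt (-(l k ^ 2 * s)) = l k * Real.sqrt (-s) := by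
      rw [show -(l k ^ 2 * s) = l k ^ 2 * (-s) by ring, Real.sqrt_mul' _ hs'.le,
        Real.sqrt_sq (hl k).le]
    rw [nsRescale_apply, norm_smul, Real.norm_of_nonneg (hl k).le]
    calc Real.sqrt (-s) * (l k * ‖u (l k ^ 2 * s) (l k • y)‖)
        = Real.sqrt (-(l k ^ 2 * s)) * ‖u (l k ^ 2 * s) (l k • y)‖ := by rw [hsq]; ring
      _ ≤ θ := key
  -- orbit limit along the scales
  obtain ⟨ψ, hψ, W, hW, -, hunif, hpt⟩ := RecurrentReductionD.orbitLimit hu hlaw l hl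
  have hψt : Tendsto ψ atTop atTop := hψ.tendsto_atTop
  -- the limit has Type-I constant `θ`
  have hWθ : ∀ s < 0, ∀ y, Real.sqrt (-s) * ‖W s y‖ ≤ θ := by
    intro s hs y
    have h1 : Tendsto (fun j => Real.sqrt (-s) * ‖nsRescale (l (ψ j)) u s y‖) atTop
        (𝓝 (Real.sqrt (-s) * ‖W s y‖)) := ((hpt s hs y).norm).const_mul _
    exact le_of_tendsto h1 ((hψt.eventually (hev s hs)).mono fun j hj => hj y)
  have hWclass : IsTypeIAncientMild θ W := by
    refine ⟨hW.1, hW.2.1, hW.2.2.1, fun t ht x => ?_⟩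
    have hst : 0 < Real.sqrt (-t) := Real.sqrt_pos.2 (neg_pos.2 ht)
    rw [le_div_iff₀ hst, mul_comm]
    exact hWθ t ht x
  have hz : ∀ t < 0, ∀ x, W t x = 0 :=
    SimilarityEnstrophy.typeI_ancient_eq_zero_of_rate_lt_one hWclass hθ
  -- persistence: contradiction
  have hWsing := RecurrentReductionD.persistent_singularity hu hlaw hsing (fun j => l (ψ j))
    (fun j => hl _) W hunif
  obtain ⟨t, ht, x, -, hM⟩ := hWsing 1 one_pos 0
  rw [hz t ht.2 x, norm_zero] at hM
  exact lt_irrefl 0 hM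

/-- **A singular finite-dissipation profile has amplitude above `θ` in every long log-window,
for every `θ < 1`**: there is `Λ > 1` such that every backward window `[Λ²τ, τ/Λ²]` (`τ < 0`)
contains `(t, x)` with `θ < √(−t)‖u(t,x)‖`. -/
theorem amplitude_exceeds_of_singular {C K θ : ℝ} (hθ : θ < 1)
    {u : ℝ → EuclideanSpace ℝ (Fin 3) → EuclideanSpace ℝ (Fin 3)} (hu : IsTypeIAncientMild C u)
    (hlaw : ∀ s : ℝ, s < 0 → ∫⁻ x, ‖fderiv ℝ (u s) x‖ₑ ^ 2 ≤ ENNReal.ofReal (K / Real.sqrt (-s)))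
    (hsing : ∀ r > 0, ∀ M : ℝ, ∃ t ∈ Set.Ioo (-(r ^ 2)) (0 : ℝ),
      ∃ x ∈ Metric.ball (0 : EuclideanSpace ℝ (Fin 3)) r, M < ‖u t x‖) :
    ∃ Λ : ℝ, 1 < Λ ∧ ∀ τ : ℝ, τ < 0 →
      ∃ t ∈ Set.Icc (Λ ^ 2 * τ) (τ / Λ ^ 2), ∃ x, θ < Real.sqrt (-t) * ‖u t x‖ := by
  by_contra hcon
  push Not at hcon
  exact notSingular_of_amplitude_lt_one_windows hθ hu hlaw hcon hsing

/-- **Far past**: a singular member has, for every `θ < 1` and every `T < 0`, a point `(t, x)` with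
`t ≤ T` and `θ < √(−t)‖u(t,x)‖` (`limsup_{t→−∞} sup_x √(−t)‖u‖ ≥ 1`). -/
theorem amplitude_exceeds_farPast_of_singular {C K θ : ℝ} (hθ : θ < 1)
    {u : ℝ → EuclideanSpace ℝ (Fin 3) → EuclideanSpace ℝ (Fin 3)} (hu : IsTypeIAncientMild C u)
    (hlaw : ∀ s : ℝ, s < 0 → ∫⁻ x, ‖fderiv ℝ (u s) x‖ₑ ^ 2 ≤ ENNReal.ofReal (K / Real.sqrt (-s)))
    (hsing : ∀ r > 0, ∀ M : ℝ, ∃ t ∈ Set.Ioo (-(r ^ 2)) (0 : ℝ),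
      ∃ x ∈ Metric.ball (0 : EuclideanSpace ℝ (Fin 3)) r, M < ‖u t x‖)
    {T : ℝ} (hT : T < 0) : ∃ t : ℝ, t ≤ T ∧ ∃ x, θ < Real.sqrt (-t) * ‖u t x‖ := by
  obtain ⟨Λ, hΛ, hwin⟩ := amplitude_exceeds_of_singular hθ hu hlaw hsing
  -- the window with `τ = Λ² T` lies in `t ≤ T`
  have hΛ2 : (0 : ℝ) < Λ ^ 2 := by positivity
  obtain ⟨t, ht, x, hx⟩ := hwin (Λ ^ 2 * T) (mul_neg_of_pos_of_neg hΛ2 hT)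
  refine ⟨t, ?_, x, hx⟩
  have h1 : t ≤ Λ ^ 2 * T / Λ ^ 2 := ht.2
  rwa [mul_div_cancel_left₀ _ (by positivity : Λ ^ 2 ≠ 0)] at h1

/-- **Near the apex**: a singular member has, for every `θ < 1` and every `T < 0`, a point `(t, x)`
with `T ≤ t < 0` and `θ < √(−t)‖u(t,x)‖` (`limsup_{t→0⁻} sup_x √(−t)‖u‖ ≥ 1`). -/
theorem amplitude_exceeds_nearApex_of_singular {C K θ : ℝ} (hθ : θ < 1)
    {u : ℝ → EuclideanSpace ℝ (Fin 3) → EuclideanSpace ℝ (Fin 3)} (hu : IsTypeIAncientMild C u)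
    (hlaw : ∀ s : ℝ, s < 0 → ∫⁻ x, ‖fderiv ℝ (u s) x‖ₑ ^ 2 ≤ ENNReal.ofReal (K / Real.sqrt (-s)))
    (hsing : ∀ r > 0, ∀ M : ℝ, ∃ t ∈ Set.Ioo (-(r ^ 2)) (0 : ℝ),
      ∃ x ∈ Metric.ball (0 : EuclideanSpace ℝ (Fin 3)) r, M < ‖u t x‖)
    {T : ℝ} (hT : T < 0) : ∃ t : ℝ, T ≤ t ∧ t < 0 ∧ ∃ x, θ < Real.sqrt (-t) * ‖u t x‖ := by
  obtain ⟨Λ, hΛ, hwin⟩ := amplitude_exceeds_of_singular hθ hu hlaw hsing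
  have hΛ2 : (0 : ℝ) < Λ ^ 2 := by positivity
  obtain ⟨t, ht, x, hx⟩ := hwin (T / Λ ^ 2) (div_neg_of_neg_of_pos hT hΛ2)
  refine ⟨t, ?_, ?_, x, hx⟩
  · have h1 : Λ ^ 2 * (T / Λ ^ 2) ≤ t := ht.1
    rwa [mul_div_cancel₀ _ hΛ2.ne'] at h1
  · have h2 : t ≤ T / Λ ^ 2 / Λ ^ 2 := ht.2
    have h3 : T / Λ ^ 2 / Λ ^ 2 < 0 := div_neg_of_neg_of_pos (div_neg_of_neg_of_pos hT hΛ2) hΛ2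
    linarith

end Summit.NavierStokesRegularity.NavierStokesRegularity.Theorems.FiniteDissipationLiouville.Amplitude

end
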